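import Literature.Barriers.QuantumAdvantage.BoundedEntanglementSimLemmas
import Literature.Computability.Cryptography.QuantumCircuitDescFP
import Literature.Computability.Complexity.CodeFPArith
import Literature.Computability.Complexity.PRelHierarchy
import HarnessLib

/-!
# The `p`-blocked simulator: the circuit description as typed data

Topic `Literature/Barriers/QuantumAdvantage`; machine half of the proof programme for
`Literature.Barriers.QuantumAdvantage.jozsaLinden2003_pblocked` (Jozsa–Linden 2003, §3). The classical
machine receives the input `z` and must work from the *description* `F.descFn z` of the `|z|`-th
circuit of the uniform family (`QuantumCircuitDescFP.lean`: `descFn ∈ FP` iff the family is uniform).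
That string is the code of a typed object, and this file says which, so that the typed
polynomial-time framework `CodeFP` (`Complexity/CodeFP.lean`) applies end to end:

* `RawGate = Bool × ℕ × List ℕ` (tag, symbol number / query width, wire list) with the code `rgE`,
  `rawOf : QGate G N → RawGate`, and **`QGate.encode g = rgE (rawOf g)`** (`encode_eq_rgE`);
  `encode_eq_rawE` (a circuit code is the raw list of its gate codes);
* `descT F z = (|z|, ancillas, gates.map rawOf)` with the code `descE = pairE natE (pairE unE (rawE rgE))`
  and **`F.descFn z = descE (descT F z)`** (`descFn_eq_descE`);
* the program's view of a gate, `gate3OfRaw g = (symbol, wire₀, wire₁)`, is computed on codes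
  (`gate3OfRaw_codeFP`), hence so is the whole typed input of the simulator,
  **`inputs_codeFP`**: for a uniform family,
  `z ↦ (|F.descFn z| + 2, ancillas, (gates.map rawOf).map gate3OfRaw, z)` is `CodeFP` from `strE`;
* the saturation width `|F.descFn z| + 2` dominates the Hadamard count: `hExp_add_two_le_width`.

## References

* R. Jozsa, N. Linden, *On the role of entanglement in quantum-computational speed-up*, Proc. R. Soc.
  Lond. A 459 (2003) 2011–2032, arXiv:quant-ph/0201143: §3, theorem `pblthm` ("given the
  description of the circuit"), lemma `ratlemma`.
* S. Arora, B. Barak, *Computational Complexity: A Modern Approach*, CUP 2009, §6.2 (uniform families: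
  the description is computed from `1ⁿ`), §1.3.
-/

noncomputable section

namespace Literature.Barriers.QuantumAdvantage

namespace PSim

open _root_.Computability Literature.Computability Literature.Computability.Complexity
  Literature.Computability.Complexity.CodeFP Literature.Computability.Cryptography

/-! ### Gates and descriptions as typed data -/

/-- A raw gate datum: the tag bit (`false` = gate symbol, `true` = oracle query), the symbol number
(resp. query width) and the list of wire indices. [cite: AroraBarak2009, §6.1 (descriptions of circuits)] -/
abbrev RawGate : Type := Bool × ℕ × List ℕ

/-- The code of a raw gate datum: tag bit, then the pair of the binary symbol code and the wire list
(with its unary length header, `listE natE`). [cite: AroraBarak2009, §6.1] -/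
def rgE : RawGate → List Bool := fun g => g.1 :: pairE natE (listE natE) (g.2.1, g.2.2)

/-- The raw datum of a placed gate. [folklore] -/
def rawOf {G : QGateSet} [Encodable G.Op] {N : ℕ} : QGate G N → RawGate
  | .gate op e => (false, Encodable.encode op, List.ofFn fun i => (e i : ℕ))
  | .oracle k e => (true, k, List.ofFn fun i => (e i : ℕ))

/-- `encodingListNatBool` codes by `listE natE`. [folklore] -/
theorem encodingListNatBool_encode (l : List ℕ) : encodingListNatBool.encode l = listE natE l := by
  rw [show (encodingListNatBool.encode : List ℕ → List Bool) = listE natE from listE_eq encodingNatBool]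

/-- **The gate code is the code of the raw datum.** [folklore] -/
theorem encode_eq_rgE {G : QGateSet} [Encodable G.Op] {N : ℕ} (g : QGate G N) : g.encode = rgE (rawOf g) := by
  cases g with
  | gate op e => simp [QGate.encode, rgE, rawOf, encodingListNatBool_encode]
  | oracle k e => simp [QGate.encode, rgE, rawOf, encodingListNatBool_encode]

/-- A circuit code is the raw list of the raw data of its gates. [folklore] -/
theorem encode_eq_rawE {G : QGateSet} [Encodable G.Op] {N : ℕ} (C : QCircuit G N) :
    C.encode = rawE rgE (C.gates.map rawOf) := by
  rw [QCircuit.encode_eq_encList, rawE, List.map_map]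
  congr 1
  exact List.map_congr_left fun g _ => encode_eq_rgE g

/-- **The typed description of the `|z|`-th circuit**: number of inputs, number of ancillas, raw gate
data. [cite: AroraBarak2009, §6.2 (uniform circuit families)] -/
def descT {G : QGateSet} [Encodable G.Op] (F : QCircuitFamily G) (z : List Bool) : ℕ × ℕ × List RawGate :=
  (z.length, F.ancillas z.length, (F.circ z.length).gates.map rawOf)

/-- The code of a typed description (`sigmaEncode`: binary input count, unary ancilla count, gate list). [folklore] -/
abbrev descE : ℕ × ℕ × List RawGate → List Bool := pairE natE (pairE unE (rawE rgE))

/-- **The description string is the code of the typed description.** [folklore] -/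
theorem descFn_eq_descE {G : QGateSet} [Encodable G.Op] (F : QCircuitFamily G) (z : List Bool) :
    F.descFn z = descE (descT F z) := by
  rw [QCircuitFamily.descFn_eq, encode_eq_rawE]
  rfl

/-- The program's view of a raw gate: symbol number and the first two wires (`0` if absent).
[cite: JozsaLinden2003, §3 (proof of lemma ratpbl: "the next gate acts on qubits from …")] -/
def gate3OfRaw (g : RawGate) : ℕ × ℕ × ℕ := (g.2.1, g.2.2.getD 0 0, g.2.2.getD 1 0)

/-- The code of the program's gate view. [folklore] -/
abbrev g3E : ℕ × ℕ × ℕ → List Bool := pairE natE (pairE natE natE)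

/-- `l.getD 1 d = l.tail.headD d`. [folklore] -/
theorem getD_one_eq_headD_tail {α : Type} (l : List α) (d : α) : l.getD 1 d = l.tail.headD d := by
  rcases l with _ | ⟨a, _ | ⟨b, l⟩⟩ <;> rfl

/-- Dropping the tag bit of a raw gate code. [folklore] -/
theorem untag_codeFP : CodeFP rgE (pairE natE (listE natE)) (fun g : RawGate => (g.2.1, g.2.2)) :=
  of_fn List.tail PRelSigma.tail_mem_FP fun g => by simp [rgE]

/-- **The gate view is computed on codes.** [folklore] -/
theorem gate3OfRaw_codeFP : CodeFP rgE g3E gate3OfRaw := by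
  have hk : CodeFP rgE natE (fun g : RawGate => g.2.1) := untag_codeFP.fst'
  have hw : CodeFP rgE (rawE natE) (fun g : RawGate => g.2.2) :=
    ((rawOfList natE).comp untag_codeFP.snd').congr fun _ => rfl
  have h0 : CodeFP rgE natE (fun g : RawGate => g.2.2.getD 0 0) :=
    ((rawHeadD natE (d := 0) natE_zero).comp hw).congr fun g => by
      rcases g with ⟨b, k, _ | ⟨w, ws⟩⟩ <;> rfl
  have h1 : CodeFP rgE natE (fun g : RawGate => g.2.2.getD 1 0) :=
    ((rawHeadD natE (d := 0) natE_zero).comp ((rawTail natE).comp hw)).congr fun g =>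
      (getD_one_eq_headD_tail _ _).symm
  exact (hk.pair (h0.pair h1)).congr fun _ => rfl

/-- The length of the description, from the typed description. [folklore] -/
theorem descLength_codeFP : CodeFP descE unE (fun d => (descE d).length) :=
  of_fn onesFn onesFn_mem_FP fun _ => rfl

/-- The code of the simulator's typed input `(W, m, gates, x)`. [folklore] -/
abbrev inE : ℕ × ℕ × List (ℕ × ℕ × ℕ) × List Bool → List Bool :=
  pairE unE (pairE unE (pairE (rawE g3E) strE))

/-- From `(description, input)` to the simulator's typed input. [folklore] -/
theorem simInputs_codeFP :
    CodeFP (pairE descE strE) inE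
      (fun t => ((descE t.1).length + 2, t.1.2.1, t.1.2.2.map gate3OfRaw, t.2)) := by
  have hd : CodeFP (pairE descE strE) descE Prod.fst := fst _ _
  have hW : CodeFP (pairE descE strE) unE (fun t => (descE t.1).length + 2) :=
    (unSucc.comp (unSucc.comp (descLength_codeFP.comp hd))).congr fun _ => rfl
  have hm : CodeFP (pairE descE strE) unE (fun t => t.1.2.1) := (hd.snd').fst'
  have hg : CodeFP (pairE descE strE) (rawE g3E) (fun t => t.1.2.2.map gate3OfRaw) :=
    (map₀ gate3OfRaw_codeFP).comp (hd.snd').snd'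
  have hx : CodeFP (pairE descE strE) strE Prod.snd := snd _ _
  exact hW.pair (hm.pair (hg.pair hx))

/-- **The simulator's typed input is computed from the input string of a uniform family**:
`z ↦ (|F.descFn z| + 2, ancillas |z|, the gate views, z)`. [cite: AroraBarak2009, §6.2, Remark 6.7] -/
theorem inputs_codeFP {F : QCircuitFamily cliffordT} (hU : F.IsUniform) :
    CodeFP strE inE (fun z => ((F.descFn z).length + 2, F.ancillas z.length,
      ((F.circ z.length).gates.map rawOf).map gate3OfRaw, z)) := by
  have h1 : CodeFP strE (pairE descE strE) (fun z => (descT F z, z)) :=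
    of_fn (Complexity.fanoutFn F.descFn id)
      (Complexity.fanoutFn_mem_FP (QCircuitFamily.descFn_mem_FP_of_isUniform hU) (PolyTimeComputable.id _))
      fun z => by simp [descFn_eq_descE, strE]
  exact (simInputs_codeFP.comp h1).congr fun z => by simp [descT, descFn_eq_descE]

/-! ### The saturation width -/

/-- The number of gates is at most the length of the description. [folklore] -/
theorem gates_length_le_descFn (F : QCircuitFamily cliffordT) (z : List Bool) :
    (F.circ z.length).gates.length ≤ (F.descFn z).length := by
  rw [descFn_eq_descE, descE, pairE_apply, length_boolPair, pairE_apply, length_boolPair]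
  have := length_le_length_rawE rgE ((F.circ z.length).gates.map rawOf)
  rw [List.length_map] at this
  simp only [descT]
  omega

/-- **The width `|F.descFn x| + 2` exceeds the Hadamard count by two** (what the inertness of the
saturation needs, `natAbs_gramZ_ampZ_le`). [cite: JozsaLinden2003, §3 (proof of lemma ratlemma: the number of digits is O(poly))] -/
theorem hExp_add_two_le_width (F : QCircuitFamily cliffordT) (x : List Bool) (j : ℕ) :
    F.hExp x j + 2 ≤ (F.descFn x).length + 2 :=
  Nat.add_le_add_right ((hExp_le_length F x j).trans (gates_length_le_descFn F x)) 2

end PSim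

end Literature.Barriers.QuantumAdvantage

end
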